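import Summits.BirchSwinnertonDyer.BirchSwinnertonDyer.Theses.UniversalToricDescent
import Summits.BirchSwinnertonDyer.BirchSwinnertonDyer.Theorems.UniversalToricDescentToricTransportModThreeStubRatSqueeze
import Summits.BirchSwinnertonDyer.BirchSwinnertonDyer.Theorems.UniversalToricDescentAcDualMuZeroCriterion
import Literature.Barriers.BirchSwinnertonDyer.TraceZeroHeegnerTowerAtAdditiveSplitP
import HarnessLib

/-!
# NODE g10 — `coherence_glue` (crux-ideate gen 10, D-0171 node) for `AdditiveSplitIMCInclusionAtThree`

Crux (FIXED, by name): `Summit.BirchSwinnertonDyer.BirchSwinnertonDyer.Theses.UniversalToricDescent.AdditiveSplitIMCInclusionAtThree`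
(THE WALL: `(L) ⊆ Ch(X_(∅,0))·R₀⟦T⟧` at the wild additive potentially-supersingular split prime `3`, class O6,
`ρ̄₃` onto, `r_an = 1`).

## Kernel road (UNCHANGED from g8 `division_tower_mu_floor`, rc 0 there)
`RATWALL` (`RationalSplitIMCInclusionAtThree`, route crux 24207, UNDECIDED/WEAKER) and residual Selmer finiteness
`ResidualSelmerFiniteAtThreeSurj` (μ = 0 of `X_(∅,0)`, UNDECIDED) give the wall through the LANDED criterion
`UniversalToricDescentAcDualMuZero.isTorsion_and_exists_generator_of_finite_pTorsion` and `3 ∤ g ⇒ (g ∣ 3^k L → g ∣ L)`.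
`sorry` occurs ONLY inside the two registered-shape stubs `stub_ratwall`, `stub_residualFinite`.

## What is NEW in g10 (lever «Λ-coherence glue at a trace-zero prime»; leaves, not consumed by the kernel)
* §1b `natCast_smul_mem_range_of_towerNorm_eq_zero` (PROVED, pure algebra over the Literature `TraceZeroTower` API):
  a trace-zero vector is `p`-torsion modulo coboundaries — `N_{m+1,m} x = 0 ⇒ p•x ∈ (γ^{p^m} − 1)H`
  (Kolyvagin-derivative identity, no layer hypothesis needed); `range_sub_one_antitone` (PROVED): coboundary
  submodules decrease along the tower.
* §1c `EventualCoboundaryOfFiniteTorsion` (leaf, WEAKER, typed AND PROVED — `eventualCoboundaryOfFiniteTorsion_holds`): if the `p`-torsion of the coinvariants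
  `H ⧸ (γ^{p^n} − 1)H` is finite (for `H = E(K_∞) ⊗ ℤ_p` this IS finite generation of the Selmer dual — Greenberg /
  Manin — via the snake lemma for `0 → H → H ⊗ ℚ → E(K_∞) ⊗ ℚ_p/ℤ_p → 0`), then a trace-zero family is, modulo a FINITE
  set of its members, a family of `(γ^{p^n} − 1)`-COBOUNDARIES: Heegner ANTIDERIVATIVES exist in Mordell–Weil although
  Howard's Λ-adic Heegner module is `⊥` (`heegnerModule_eq_bot_of_traceZero`, in tree) and the Heegner module itself
  has no glue (`⊕ Λ/Φ_{p^m}`).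
* §1d `CyclotomicCofactorDescent` (leaf, BARRIER, typed AND PROVED — `cyclotomicCofactorDescent_holds`): the cofactors `N_{n,j} = (X^{p^n} − 1)/Φ_{p^j}`
  that generate every Φ-ISOTYPIC («valuewise») ideal of `R[X]/(X^{p^n} − 1)` acquire a factor `p` under each level
  projection — the in-Lean form of barrier B-g10-7 (valuewise / maximal-order-flat layer data has no nonzero Λ-limit;
  wall content lives at transcendental height-one primes).
Tags: RATWALL = UNDECIDED·WEAKER (crux 24207); ResidualSelmerFiniteAtThreeSurj = UNDECIDED (μ-piece, doors g3/g6/g7/g8);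
EventualCoboundaryOfFiniteTorsion = WEAKER·PROVED (pure algebra; its ARITHMETIC instantiation is ATTACKABLE: needs `E(K_∞)⊗ℤ₃` as a Γ-module + Selmer finite generation); CyclotomicCofactorDescent = BARRIER·PROVED;
the arithmetic instances (Heegner antiderivatives, winding digits in `(E(K_∞)⊗ℤ₃)_Γ[3]`) = INSTRUMENTABLE (see .md).

Convention reminders: `(L) ⊆ Ch` is `Ch ∣ L`; `XAc.charIdeal = ⊤` off the torsion locus.
-/

set_option linter.dupNamespace false
set_option autoImplicit false

noncomputable section

open Literature.NumberTheory.EllipticCurves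
open Literature.Barriers.BirchSwinnertonDyer.TraceZeroTower
open Summit.BirchSwinnertonDyer.BirchSwinnertonDyer.Theses.UniversalToricDescent
  (RationalSplitIMCInclusionAtThree AdditiveSplitIMCInclusionAtThree)
open Summit.BirchSwinnertonDyer.BirchSwinnertonDyer.Cruxes.ToricTransportModThree.RatwallThinComb
  (dvd_of_dvd_prime_pow_mul prime_C_three not_C_three_dvd_of_norm_coeff_eq_one)
open Summit.BirchSwinnertonDyer.Rank1Residual.X11b

namespace Summit.BirchSwinnertonDyer.BirchSwinnertonDyer.Cruxes.AdditiveSplitIMCInclusionAtThree.CoherenceGlue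

/-! ## §1a The μ-piece of the kernel road (verbatim from g8, same normalised signature) -/

/-- μ-piece (UNDECIDED): residual `(∅,0)`-Selmer finiteness `Sel_{𝔭′}(K_∞, E[3^∞])[3]` finite on the O6 / onto /
`r_an = 1` rows — equivalently `μ(X_(∅,0)) = 0` given torsion. Identical text to g8 `DivisionTowerMuFloor`.
[cite: GreenbergVatsal2000, §2 Prop. (2.8)] -/
def ResidualSelmerFiniteAtThreeSurj : Prop :=
  ∀ (W : WeierstrassCurve ℚ) [W.IsElliptic] [W.IsGloballyMinimal] (N : ℕ) [NeZero N] (K : Type) [Field K] [NumberField K], Summit.BirchSwinnertonDyer.Rank1Residual.Additive.ClassO6 W 3 → W.HasSurjectiveModNGaloisRep 3 → W.analyticRank = 1 → W.conductorNorm ℤ = N → Literature.NumberTheory.EllipticCurves.IsImaginaryQuadratic K → Literature.NumberTheory.EllipticCurves.SatisfiesHeegnerHypothesis N K → ∀ (κ : Literature.NumberTheory.EllipticCurves.ZpExtension K 3), κ.IsAnticyclotomic → ∀ (𝔭' : IsDedekindDomain.HeightOneSpectrum (NumberField.RingOfIntegers K)), ((3 : ℕ) : NumberField.RingOfIntegers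 K) ∈ 𝔭'.asIdeal → Set.Finite {s : Summit.BirchSwinnertonDyer.Rank1Residual.X11b.AcSelmer.selmerAc (W.baseChange K) 3 κ 𝔭' ∅ | (3 : ℕ) • s = 0}

/-! ## §1b Coherence glue, proved part: trace zero ⇒ p-torsion modulo coboundaries -/

section Algebra

universe u v

variable {R : Type u} [CommRing R] {H : Type v} [AddCommGroup H] [Module R H]

/-- **Kolyvagin-derivative identity, coboundary form.** If the relative norm `N_{m+1,m} = Σ_{i<p} γ^{i p^m}` kills
`x`, then `p • x` is a `(γ^{p^m} − 1)`-coboundary: `p•x = N x − Σ_i (γ^{i p^m} − 1) x` and each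
`γ^{i p^m} − 1 = (γ^{p^m} − 1)·(1 + … )`. No layer hypothesis on `x` is used.
[cite: BertoliniDarmon1996, §2.4 «Formal properties» (norm operators)] -/
theorem natCast_smul_mem_range_of_towerNorm_eq_zero (γ : Module.End R H) (p m : ℕ) {x : H}
    (hx : towerNorm γ p m x = 0) : (p : R) • x ∈ LinearMap.range (γ ^ (p ^ m) - 1) := by
  have hsum : ∑ i ∈ Finset.range p, (((γ ^ (p ^ m)) ^ i - 1) x)
      = towerNorm γ p m x - (p : R) • x := by
    rw [towerNorm, LinearMap.sum_apply, Nat.cast_smul_eq_nsmul]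
    simp only [LinearMap.sub_apply, Module.End.one_apply, Finset.sum_sub_distrib, Finset.sum_const,
      Finset.card_range]
  have key : (p : R) • x = -∑ i ∈ Finset.range p, (((γ ^ (p ^ m)) ^ i - 1) x) := by
    rw [hsum, hx, zero_sub, neg_neg]
  rw [key]
  refine Submodule.neg_mem _ (Submodule.sum_mem _ fun i _ => ?_)
  have hfac : (γ ^ (p ^ m)) ^ i - 1 = (γ ^ (p ^ m) - 1) * ∑ j ∈ Finset.range i, (γ ^ (p ^ m)) ^ j :=
    (mul_geom_sum (γ ^ (p ^ m)) i).symm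
  rw [hfac, Module.End.mul_apply]
  exact LinearMap.mem_range_self _ _

/-- For a trace-zero family, `p • y_{m+1}` is a `(γ^{p^m} − 1)`-coboundary for every `m`.
[cite: BertoliniDarmon1996, §2.5 Case 2 (p. 435)] -/
theorem natCast_smul_mem_range_of_isTraceZeroFamily (γ : Module.End R H) (p : ℕ) {y : ℕ → H}
    (hy : IsTraceZeroFamily γ p y) (m : ℕ) :
    (p : R) • y (m + 1) ∈ LinearMap.range (γ ^ (p ^ m) - 1) :=
  natCast_smul_mem_range_of_towerNorm_eq_zero γ p m (hy.2 m)

/-- Coboundary submodules decrease along the tower: `(γ^{p^m} − 1)H ⊆ (γ^{p^n} − 1)H` for `n ≤ m`, because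
`γ^{p^m} − 1 = (γ^{p^n} − 1)·(geometric sum in γ^{p^n})`. [cite: BertoliniDarmon1996, §2.4] -/
theorem range_sub_one_antitone (γ : Module.End R H) (p : ℕ) {n m : ℕ} (hnm : n ≤ m) :
    LinearMap.range (γ ^ (p ^ m) - 1) ≤ LinearMap.range (γ ^ (p ^ n) - 1) := by
  obtain ⟨k, rfl⟩ := Nat.exists_eq_add_of_le hnm
  have hfac : γ ^ (p ^ (n + k)) - 1 = (γ ^ (p ^ n) - 1) * ∑ j ∈ Finset.range (p ^ k), (γ ^ (p ^ n)) ^ j := by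
    rw [mul_geom_sum, ← pow_mul, ← pow_add]
  rw [hfac]
  exact LinearMap.range_comp_le_range _ _

/-- Hence, for a trace-zero family, `p • y_m ∈ (γ^{p^n} − 1)H` for all `m > n`: modulo coboundaries of ANY fixed
level the whole tail of the family is `p`-torsion. [cite: BertoliniDarmon1996, §2.5 Case 2] -/
theorem natCast_smul_mem_range_of_lt (γ : Module.End R H) (p : ℕ) {y : ℕ → H}
    (hy : IsTraceZeroFamily γ p y) {n m : ℕ} (hnm : n < m) :
    (p : R) • y m ∈ LinearMap.range (γ ^ (p ^ n) - 1) := by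
  obtain ⟨k, rfl⟩ := Nat.exists_eq_add_of_lt hnm
  have h := natCast_smul_mem_range_of_isTraceZeroFamily γ p hy (n + k)
  exact range_sub_one_antitone γ p (Nat.le_add_right n k) h

end Algebra

/-! ## §1c Leaf (WEAKER, PROVED below): eventual coboundaries from finiteness of torsion in the coinvariants -/

/-- **Eventual-coboundary principle (coherence glue).** For a trace-zero family `y` in an `R`-module `H` with
`γ`, and a level `n`: if the `p`-torsion of the coinvariants `H ⧸ (γ^{p^n} − 1)H` is finite, then there is a
FINITE set `S` of indices such that every `y_m` is a `(γ^{p^n} − 1)`-coboundary modulo the `R`-span of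
`{y_i : i ∈ S}`. (By §1b the classes of `y_m`, `m > n`, lie in that finite torsion; a submodule of a finite module
is generated by finitely many of any generating family.) For `H = E(K_∞) ⊗ ℤ_p` along the anticyclotomic tower the
hypothesis follows from finite generation of the `p^∞`-Selmer dual over `Λ` (snake lemma: the torsion of the
coinvariants injects into a quotient of `(E(K_∞)⊗ℚ_p/ℤ_p)^{Γ_n}`, which is cofinitely generated).
[cite: Greenberg1999LNM1716, Thm. 1.2 / §4 (finite generation of Selmer duals)] [cite: BertoliniDarmon1996, §2.5] -/
def EventualCoboundaryOfFiniteTorsion : Prop :=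
  ∀ {R : Type} [CommRing R] {H : Type} [AddCommGroup H] [Module R H] (γ : Module.End R H) (p : ℕ) (y : ℕ → H),
    IsTraceZeroFamily γ p y → ∀ n : ℕ,
      Set.Finite {x : H ⧸ LinearMap.range (γ ^ (p ^ n) - 1) | (p : R) • x = 0} →
      ∃ S : Finset ℕ, ∀ m : ℕ,
        y m ∈ LinearMap.range (γ ^ (p ^ n) - 1) ⊔ Submodule.span R (y '' (S : Set ℕ))

/-- **`EventualCoboundaryOfFiniteTorsion` holds** (PROVED): the classes of the tail `y_m`, `m > n`, are
`p`-torsion in the coinvariants (§1b), hence take finitely many values; one representative index per value plus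
the head `m ≤ n` is the finite set `S`. [cite: BertoliniDarmon1996, §2.5 Case 2] -/
theorem eventualCoboundaryOfFiniteTorsion_holds : EventualCoboundaryOfFiniteTorsion := by
  intro R _ H _ _ γ p y hy n hfin
  classical
  set W : Submodule R H := LinearMap.range (γ ^ (p ^ n) - 1) with hW
  have hcls : ∀ m, n < m → (p : R) • (W.mkQ (y m)) = 0 := fun m hm => by
    rw [← map_smul, Submodule.mkQ_apply, Submodule.Quotient.mk_eq_zero]
    exact natCast_smul_mem_range_of_lt γ p hy hm
  set A : Set (H ⧸ W) := (fun m => W.mkQ (y m)) '' {m | n < m} with hA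
  have hAfin : A.Finite := by
    refine hfin.subset ?_
    rintro _ ⟨m, hm, rfl⟩
    exact hcls m hm
  have hrep : ∀ a ∈ A, ∃ m, n < m ∧ W.mkQ (y m) = a := fun a ⟨m, hm, h⟩ => ⟨m, hm, h⟩
  choose! idx hidx using hrep
  refine ⟨Finset.range (n + 1) ∪ hAfin.toFinset.image idx, fun m => ?_⟩
  by_cases hm : n < m
  · have ha : W.mkQ (y m) ∈ A := ⟨m, hm, rfl⟩
    obtain ⟨-, heq⟩ := hidx _ ha
    have hdiff : y m - y (idx (W.mkQ (y m))) ∈ W :=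
      (Submodule.Quotient.eq W).mp (by simpa only [Submodule.mkQ_apply] using heq.symm)
    have hmem : y (idx (W.mkQ (y m)))
        ∈ Submodule.span R (y '' ↑(Finset.range (n + 1) ∪ hAfin.toFinset.image idx)) := by
      refine Submodule.subset_span ⟨idx (W.mkQ (y m)), ?_, rfl⟩
      simp only [Finset.coe_union, Finset.coe_image, Set.mem_union, Set.mem_image, Finset.mem_coe,
        Set.Finite.mem_toFinset]
      exact Or.inr ⟨_, ha, rfl⟩
    have hsplit : y m = (y m - y (idx (W.mkQ (y m)))) + y (idx (W.mkQ (y m))) := by abel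
    rw [hsplit]
    exact Submodule.add_mem_sup hdiff hmem
  · rw [not_lt] at hm
    refine Submodule.mem_sup_right (Submodule.subset_span ⟨m, ?_, rfl⟩)
    simp only [Finset.coe_union, Set.mem_union, Finset.mem_coe, Finset.mem_range]
    exact Or.inl (by omega)

/-! ## §1d Leaf (BARRIER, PROVED below): Φ-isotypic («valuewise») data picks up a factor `p` per level -/

/-- The cofactor `N_{n,j} = ∏_{i ≤ n, i ≠ j} Φ_{p^i}(X) = (X^{p^n} − 1)/Φ_{p^j}(X)`; the ideal it generates in
`R[X]/(X^{p^n} − 1)` is the `Φ_{p^j}`-isotypic («valuewise at the characters of conductor `p^j`») part.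
[cite: Washington1997, §13.2 (cyclotomic factors of `(1+T)^{p^n} − 1`)] -/
def cycCofactor (R : Type) [CommRing R] (p n j : ℕ) : Polynomial R :=
  ∏ i ∈ (Finset.range (n + 1)).erase j, Polynomial.cyclotomic (p ^ i) R

/-- **Cyclotomic cofactor descent** (barrier B-g10-7 in provable form): under the level projection
`R[X]/(X^{p^{n+1}} − 1) → R[X]/(X^{p^n} − 1)` every isotypic generator `N_{n+1,j}` (`j ≤ n`) becomes `p·N_{n,j}`
(because `Φ_{p^{n+1}}(X) = Σ_{k<p} X^{k p^n} ≡ p`), and `N_{n+1,n+1} = X^{p^n} − 1` dies. Consequently a compatible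
system of VALUEWISE (isotypic-sum) elements is divisible by every power of `p`, i.e. zero in `Λ = lim R[X]/(X^{p^n}−1)`
for `p`-adically separated `R`: character-wise / maximal-order-flat layer data (Heegner modules, local points,
equivariant Fitting ideals of flat quotients) has no nonzero Λ-adic limit.
[cite: Washington1997, §13.2] [cite: MazurRubin2004, §5.1 (Kolyvagin systems vs. layer-wise data)] -/
def CyclotomicCofactorDescent : Prop :=
  ∀ (R : Type) [CommRing R] (p : ℕ), p.Prime → ∀ n j : ℕ, j ≤ n →
    (∃ q : Polynomial R,
        cycCofactor R p (n + 1) j = (p : Polynomial R) * cycCofactor R p n j + q * (Polynomial.X ^ (p ^ n) - 1)) ∧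
      cycCofactor R p (n + 1) (n + 1) = Polynomial.X ^ (p ^ n) - 1

/-- `∏_{i ≤ n} Φ_{p^i}(X) = X^{p^n} − 1`. [cite: Washington1997, §13.2] -/
theorem prod_range_cyclotomic_prime_pow (R : Type) [CommRing R] {p : ℕ} (hp : p.Prime) (n : ℕ) :
    ∏ i ∈ Finset.range (n + 1), Polynomial.cyclotomic (p ^ i) R = Polynomial.X ^ (p ^ n) - 1 := by
  rw [← Nat.prod_divisors_prime_pow hp (f := fun i => Polynomial.cyclotomic i R)]
  exact Polynomial.prod_cyclotomic_eq_X_pow_sub_one (pow_pos hp.pos n) R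

/-- `Σ_{i<p} Y^i = p + q·(Y − 1)` with `Y = X^{p^n}`: the geometric sum is `p` modulo `X^{p^n} − 1`.
[cite: Washington1997, §13.2] -/
theorem exists_geom_sum_X_pow_eq (R : Type) [CommRing R] (p n : ℕ) :
    ∃ q : Polynomial R, ∑ i ∈ Finset.range p, (Polynomial.X ^ p ^ n) ^ i
      = (p : Polynomial R) + q * (Polynomial.X ^ (p ^ n) - 1) := by
  refine ⟨∑ i ∈ Finset.range p, ∑ j ∈ Finset.range i, (Polynomial.X ^ p ^ n) ^ j, ?_⟩
  rw [Finset.sum_mul]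
  simp_rw [geom_sum_mul]
  rw [Finset.sum_sub_distrib, Finset.sum_const, Finset.card_range, Nat.smul_one_eq_cast]
  ring

/-- **`CyclotomicCofactorDescent` holds** (barrier B-g10-7 in provable form, PROVED): `N_{n+1,j} ≡ p·N_{n,j}`
modulo `X^{p^n} − 1` for `j ≤ n`, and `N_{n+1,n+1} = X^{p^n} − 1`. [cite: Washington1997, §13.2] -/
theorem cyclotomicCofactorDescent_holds : CyclotomicCofactorDescent := by
  intro R _ p hp n j hj
  constructor
  · have hsplit : cycCofactor R p (n + 1) j
        = cycCofactor R p n j * Polynomial.cyclotomic (p ^ (n + 1)) R := by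
      unfold cycCofactor
      rw [Finset.range_add_one, Finset.erase_insert_of_ne (by omega : n + 1 ≠ j),
        Finset.prod_insert (by simp), mul_comm]
    obtain ⟨q, hq⟩ := exists_geom_sum_X_pow_eq R p n
    refine ⟨cycCofactor R p n j * q, ?_⟩
    rw [hsplit, Polynomial.cyclotomic_prime_pow_eq_geom_sum hp, hq]
    ring
  · unfold cycCofactor
    rw [Finset.range_add_one, Finset.erase_insert (by simp)]
    exact prod_range_cyclotomic_prime_pow R hp n

/-! ## §2 Registered-shape stubs (`sorry` only here) -/

/-- RATWALL (route crux 24207 `RationalSplitIMCInclusionAtThree`, UNDECIDED·WEAKER): `(3^k L) ⊆ Ch·R₀⟦T⟧`. -/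
theorem stub_ratwall : RationalSplitIMCInclusionAtThree := by
  sorry

/-- μ-piece (UNDECIDED): residual `(∅,0)`-Selmer finiteness at `3` on the O6 / onto / `r_an = 1` rows. -/
theorem stub_residualFinite : ResidualSelmerFiniteAtThreeSurj := by
  sorry

/-! ## §3 TOP composition: RATWALL + residual finiteness ⟹ THE WALL (kernel road of g8, by name) -/

/-- **The wall from the rational wall and residual Selmer finiteness.** `Sel_{𝔭′}(K_∞,E[3^∞])[3]` finite makes
`X = X_(∅,0)` `Λ`-torsion with `Ch·R₀⟦T⟧ = (g)`, `g` having a unit coefficient (LANDED criterion, GV 2.8 shape);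
then `3 ∤ g` in the domain `R₀⟦T⟧` where `3` is prime, so `g ∣ 3^k·L` (RATWALL) forces `g ∣ L`, i.e. `(L) ⊆ (g)`.
Concludes the crux `AdditiveSplitIMCInclusionAtThree` BY NAME.
[cite: GreenbergVatsal2000, §2 Prop. (2.8)] [cite: Washington1997, §7.1, §13.2] -/
theorem AdditiveSplitIMCInclusionAtThree_of :
    RationalSplitIMCInclusionAtThree → ResidualSelmerFiniteAtThreeSurj → AdditiveSplitIMCInclusionAtThree := by
  intro hR hF W _ _ N _ K _ _ Dt hO6 hsurj hr1 hN hK hH κ hκ γ _ 𝔭 h3 he hf 𝔭' h3' hne ι' hι ΩK Ωp L hΩK hΩp hL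
  obtain ⟨k, hk⟩ := hR W N K Dt hO6 hsurj hr1 hN hK hH κ hκ γ 𝔭 h3 he hf 𝔭' h3' hne ι' hι ΩK Ωp L hΩK hΩp hL
  have hfin := hF W N K hO6 hsurj hr1 hN hK hH κ hκ 𝔭' h3'
  obtain ⟨-, g, hg, i, hi⟩ :=
    Summit.BirchSwinnertonDyer.BirchSwinnertonDyer.Theorems.UniversalToricDescentAcDualMuZero.isTorsion_and_exists_generator_of_finite_pTorsion
      (W.baseChange K) 3 κ 𝔭' ∅ γ Set.finite_empty hfin
  rw [hg] at hk ⊢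
  have hdvd : g ∣ ((3 : ℕ) : UnrSeries 3) ^ k * L := Ideal.mem_span_singleton.mp hk
  rw [← map_natCast (PowerSeries.C (R := unrIntegers 3))] at hdvd
  exact Ideal.span_singleton_le_span_singleton.mpr
    (dvd_of_dvd_prime_pow_mul prime_C_three (not_C_three_dvd_of_norm_coeff_eq_one hi) k hdvd)

/-- The top composition run on the registered-shape stubs: the crux BY NAME (sorries only through `stub_*`). -/
theorem AdditiveSplitIMCInclusionAtThree_holds_of_stubs : AdditiveSplitIMCInclusionAtThree :=
  AdditiveSplitIMCInclusionAtThree_of stub_ratwall stub_residualFinite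

end Summit.BirchSwinnertonDyer.BirchSwinnertonDyer.Cruxes.AdditiveSplitIMCInclusionAtThree.CoherenceGlue

end
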